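import Literature.Probability.Percolation.FiveArmExponentFacts
import Literature.Probability.Percolation.ArmEventsStructure
import Literature.Probability.Percolation.NearCriticalFourArmFactsSymm
import HarnessLib

/-!
# The five-arm upper bound `α₅ ≤ 2`: normal form of the recorded fact (two colour counts, large inner radii)

Topic `Literature/Probability/Percolation`; family `crit-perc`. PROOFS ONLY (no definition, no
named fact). Bookkeeping for the named fact `Nolin2008_thm24_fiveArm_upper`
(`FiveArmExponentFacts.lean`; P. Nolin, *Near-critical percolation in two dimensions*, EJP 13
(2008), §5.2, Thm. 24, five-arm item [arXiv 0711.4948: Thm. 23 (iii)]: "For any non-constant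
`σ ∈ 𝔖̃₅`, `P_{1/2}(A_{5,σ}(0,N)) ≍ N^{-2}`", recorded ORDER-FREE for every non-constant colour
vector `κ : Fin 5 → Bool` and every inner radius `m ≥ 1`), reducing its `30` colour vectors and
all inner radii to TWO colour vectors at LARGE inner radii:

* `fin5_monotone_cases` — a monotone non-constant `g : Fin 5 → Bool` is one of the four step
  functions (decided);
* `polyArmProb_eq_one_or_two` — **for every non-constant `κ`, `P_{1/2}(armEvent κ m n)` equals
  `P_{1/2}(armEvent (T,F,F,F,F) m n)` for all `m, n`, or `P_{1/2}(armEvent (T,F,T,F,F) m n)` for all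
  `m, n`**: the order-free event does not see the labelling of the arms (`armEvent_comp_equiv`,
  sorting the colours with `Tuple.sort`), and at `p = 1/2` flipping all colours does not change the
  probability (`polyArmProb_not`; Nolin, §2.1; Smirnov–Werner 2001, Rem. 2), so only the number
  `k ∈ {1, 2, 3, 4}` of black arms matters, and `k ↔ 5 - k`;
* `fiveArm_pointUpper_of_eventually` — **the inner radius**: the arm event GROWS with the inner
  radius (`armEvent_mono_left`), so bounds `P(armEvent κ m n) ≤ C(m)/n²` for all LARGE `m ≥ m₀`
  give them for all `m ≥ 1` (for `m < m₀`: `P(m,n) ≤ P(m₀,n)` when `n ≥ m₀`, and `P ≤ 1 ≤ m₀²/n²`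
  when `n < m₀`) — Nolin's §4.1 remark "for any fixed `n₁, n₂ ≥ n₀(j)`,
  `P̂(A_{j,σ}(n₁,N)) ≍ P̂(A_{j,σ}(n₂,N))`" is needed in ONE direction only, the free one;
* `Nolin2008_thm24_fiveArm_upper_iff` — **normal form**: the recorded fact is EQUIVALENT to the two
  statements `∃ m₀, ∀ m ≥ m₀, ∃ C, ∀ n ≥ m, P_{1/2}(armEvent κ m n) ≤ C/n²` for
  `κ = (T,F,F,F,F)` (one arm of one colour, four of the other: Kesten–Sidoravicius–Zhang's
  "one vacant, four occupied", one cyclic class) and `κ = (T,F,T,F,F)` (the colour vector of the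
  tree's `fiveArm_lowerBound` and of `FiveArmUpperT`; two cyclic classes, `BBWWW` and `BWBWW`).

## References

* P. Nolin, Near-critical percolation in two dimensions, *Electron. J. Probab.* 13 (2008)
  1562–1623, §2.1 (colour exchange at `p = 1/2`), §4.1 (`A_{j,σ}`, dependence on the inner radius),
  §5.2 Thm. 24 (arXiv 0711.4948: Thm. 23 (iii)) [Nolin2008].
* H. Kesten, V. Sidoravicius, Y. Zhang, Almost all words are seen in critical site percolation on
  the triangular lattice, *Electron. J. Probab.* 3 (1998), Lemma 5, (3.7)–(3.8)
  [KestenSidoraviciusZhang1998].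
* S. Smirnov, W. Werner, Critical exponents for two-dimensional percolation, *Math. Res. Lett.* 8
  (2001), Rem. 2 ("Changing the colors") [SmirnovWernerMRL2001].

## Mathlib / tree

Mathlib: `Tuple.sort`, `Tuple.monotone_sort`, `Fin.revPerm`, `Equiv.swap`. Tree:
`Nolin2008_thm24_fiveArm_upper` (`FiveArmExponentFacts.lean`), `armEvent_comp_equiv`
(`NearCriticalFourArmFactsSymm.lean`), `polyArmProb_not` (`ArmEventsStructure.lean`),
`armEvent_mono_left`, `polyArmProb_le_one` (`ArmEventsProofs.lean`).
-/

noncomputable section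

open MeasureTheory

namespace Literature.Probability.Percolation

open LatticeModels

/-! ### Sorting the colours of an order-free arm event -/

/-- **The four monotone non-constant colourings of `Fin 5`** (step functions with `k = 1, 2, 3, 4`
values `true`). [folklore] -/
theorem fin5_monotone_cases :
    ∀ g : Fin 5 → Bool, (∀ a b : Fin 5, a ≤ b → g a ≤ g b) → (∃ i j, g i ≠ g j) →
      g = ![false, false, false, false, true] ∨ g = ![false, false, false, true, true] ∨
        g = ![false, false, true, true, true] ∨ g = ![false, true, true, true, true] := by
  decide

/-- Relabelling the arms does not change the arm probability (`armEvent_comp_equiv`). [folklore] -/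
theorem polyArmProb_comp_equiv {k : ℕ} (κ : Fin k → Bool) (e : Fin k ≃ Fin k) (r R : ℕ) :
    polyArmProb (κ ∘ e) r R = polyArmProb κ r R := by
  rw [polyArmProb, polyArmProb, armEvent_comp_equiv]

/-- Sorting the colours: `P_{1/2}(armEvent κ) = P_{1/2}(armEvent (κ ∘ sort κ))` with
`κ ∘ sort κ` monotone. [folklore] -/
theorem polyArmProb_eq_sort (κ : Fin 5 → Bool) (r R : ℕ) :
    polyArmProb κ r R = polyArmProb (κ ∘ Tuple.sort κ) r R :=
  (polyArmProb_comp_equiv κ (Tuple.sort κ) r R).symm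

/-- The one-black-arm representative, sorted. [folklore] -/
theorem vec_TFFFF_comp_rev :
    ((![true, false, false, false, false] : Fin 5 → Bool) ∘ Fin.revPerm) =
      ![false, false, false, false, true] := by
  decide

/-- The `(T,F,T,F,F)` representative, sorted by two transpositions. [folklore] -/
theorem vec_TFTFF_comp_swap :
    ((![true, false, true, false, false] : Fin 5 → Bool) ∘
        ((Equiv.swap (0 : Fin 5) 4).trans (Equiv.swap (2 : Fin 5) 3))) =
      ![false, false, false, true, true] := by
  decide

/-- Three black arms are the colour flip of two, relabelled. [folklore] -/
theorem vec_FFTTT_eq_not :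
    (![false, false, true, true, true] : Fin 5 → Bool) =
      fun j => !((![false, false, false, true, true] : Fin 5 → Bool) ∘ Fin.revPerm) j := by
  decide

/-- Four black arms are the colour flip of one, relabelled. [folklore] -/
theorem vec_FTTTT_eq_not :
    (![false, true, true, true, true] : Fin 5 → Bool) =
      fun j => !((![false, false, false, false, true] : Fin 5 → Bool) ∘ Fin.revPerm) j := by
  decide

/-- `P_{1/2}(armEvent (F,F,F,F,T)) = P_{1/2}(armEvent (T,F,F,F,F))`. [folklore] -/
theorem polyArmProb_FFFFT (r R : ℕ) :
    polyArmProb ![false, false, false, false, true] r R =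
      polyArmProb ![true, false, false, false, false] r R := by
  rw [← vec_TFFFF_comp_rev, polyArmProb_comp_equiv]

/-- `P_{1/2}(armEvent (F,F,F,T,T)) = P_{1/2}(armEvent (T,F,T,F,F))`. [folklore] -/
theorem polyArmProb_FFFTT (r R : ℕ) :
    polyArmProb ![false, false, false, true, true] r R =
      polyArmProb ![true, false, true, false, false] r R := by
  rw [← vec_TFTFF_comp_swap, polyArmProb_comp_equiv]

/-- `P_{1/2}(armEvent (F,F,T,T,T)) = P_{1/2}(armEvent (T,F,T,F,F))` (colour flip at `p = 1/2`,
Smirnov–Werner 2001, Rem. 2; Nolin 2008, §2.1). [cite: SmirnovWernerMRL2001, Rem. 2] -/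
theorem polyArmProb_FFTTT (r R : ℕ) :
    polyArmProb ![false, false, true, true, true] r R =
      polyArmProb ![true, false, true, false, false] r R := by
  rw [vec_FFTTT_eq_not, polyArmProb_not, polyArmProb_comp_equiv, polyArmProb_FFFTT]

/-- `P_{1/2}(armEvent (F,T,T,T,T)) = P_{1/2}(armEvent (T,F,F,F,F))` (colour flip at `p = 1/2`,
Smirnov–Werner 2001, Rem. 2; Nolin 2008, §2.1). [cite: SmirnovWernerMRL2001, Rem. 2] -/
theorem polyArmProb_FTTTT (r R : ℕ) :
    polyArmProb ![false, true, true, true, true] r R =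
      polyArmProb ![true, false, false, false, false] r R := by
  rw [vec_FTTTT_eq_not, polyArmProb_not, polyArmProb_comp_equiv, polyArmProb_FFFFT]

/-- **Two colour vectors suffice.** For every non-constant `κ : Fin 5 → Bool`, the order-free
five-arm probability `P_{1/2}(armEvent κ m n)` coincides, for all radii, either with that of
`(T,F,F,F,F)` (one arm of a colour and four of the other) or with that of `(T,F,T,F,F)` (two and
three): the event does not depend on the labelling of the arms, and at `p = 1/2` not on a global
colour flip (Nolin 2008, §2.1, §4.1; Smirnov–Werner 2001, Rem. 2). [cite: Nolin2008, §4.1 and §2.1 (arXiv 0711.4948)] [cite: SmirnovWernerMRL2001, Rem. 2] -/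
theorem polyArmProb_eq_one_or_two (κ : Fin 5 → Bool) (hκ : ∃ i j, κ i ≠ κ j) :
    (∀ m n, polyArmProb κ m n = polyArmProb ![true, false, false, false, false] m n) ∨
      (∀ m n, polyArmProb κ m n = polyArmProb ![true, false, true, false, false] m n) := by
  set g : Fin 5 → Bool := κ ∘ Tuple.sort κ with hg
  have hmono : ∀ a b : Fin 5, a ≤ b → g a ≤ g b := fun a b hab => Tuple.monotone_sort κ hab
  have hnc : ∃ i j, g i ≠ g j := by
    obtain ⟨i, j, hij⟩ := hκ
    refine ⟨(Tuple.sort κ).symm i, (Tuple.sort κ).symm j, ?_⟩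
    simpa only [hg, Function.comp_apply, Equiv.apply_symm_apply] using hij
  have hsort : ∀ m n, polyArmProb κ m n = polyArmProb g m n := fun m n => polyArmProb_eq_sort κ m n
  rcases fin5_monotone_cases g hmono hnc with h | h | h | h
  · left; intro m n; rw [hsort, h, polyArmProb_FFFFT]
  · right; intro m n; rw [hsort, h, polyArmProb_FFFTT]
  · right; intro m n; rw [hsort, h, polyArmProb_FFTTT]
  · left; intro m n; rw [hsort, h, polyArmProb_FTTTT]

/-! ### Large inner radii suffice -/

/-- **The inner radius is free downwards.** If `P_{1/2}(armEvent κ m n) ≤ C(m)/n²` (`n ≥ m`) holds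
for all inner radii `m ≥ m₀`, it holds for all `m ≥ 1`: the arm event grows with the inner radius
(`armEvent_mono_left`; Nolin 2008, §4.1, "`P̂(A_{j,σ}(n₁,N)) ≍ P̂(A_{j,σ}(n₂,N))` for fixed
`n₁, n₂`", the trivial direction), and the finitely many `n < m₀` are absorbed in the constant
`max(C(m₀), m₀²)`. [cite: Nolin2008, §4.1 (arXiv 0711.4948, p. 8: dependence on the inner radius)] -/
theorem fiveArm_pointUpper_of_eventually {k : ℕ} (κ : Fin k → Bool)
    (h : ∃ m₀ : ℕ, ∀ m : ℕ, m₀ ≤ m → ∃ C : ℝ, ∀ n : ℕ, m ≤ n → polyArmProb κ m n ≤ C / (n : ℝ) ^ 2)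
    (m : ℕ) (hm : 1 ≤ m) : ∃ C : ℝ, ∀ n : ℕ, m ≤ n → polyArmProb κ m n ≤ C / (n : ℝ) ^ 2 := by
  obtain ⟨m₀, hm₀⟩ := h
  by_cases hle : m₀ ≤ m
  · exact hm₀ m hle
  rw [not_le] at hle
  obtain ⟨C₀, hC₀⟩ := hm₀ m₀ le_rfl
  refine ⟨max C₀ ((m₀ : ℝ) ^ 2), fun n hn => ?_⟩
  have hn1 : (1 : ℝ) ≤ n := by exact_mod_cast hm.trans hn
  have hn2 : (0 : ℝ) < (n : ℝ) ^ 2 := by positivity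
  by_cases hnm : m₀ ≤ n
  · calc polyArmProb κ m n ≤ polyArmProb κ m₀ n := by
          unfold polyArmProb
          exact measureReal_mono (armEvent_mono_left κ hle.le hnm) (measure_ne_top _ _)
      _ ≤ C₀ / (n : ℝ) ^ 2 := hC₀ n hnm
      _ ≤ max C₀ ((m₀ : ℝ) ^ 2) / (n : ℝ) ^ 2 :=
          div_le_div_of_nonneg_right (le_max_left _ _) hn2.le
  · rw [not_le] at hnm
    have hnm' : (n : ℝ) ^ 2 ≤ (m₀ : ℝ) ^ 2 := by
      have : (n : ℝ) ≤ m₀ := by exact_mod_cast hnm.le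
      nlinarith
    calc polyArmProb κ m n ≤ 1 := polyArmProb_le_one κ m n
      _ ≤ (m₀ : ℝ) ^ 2 / (n : ℝ) ^ 2 := by rw [le_div_iff₀ hn2, one_mul]; exact hnm'
      _ ≤ max C₀ ((m₀ : ℝ) ^ 2) / (n : ℝ) ^ 2 :=
          div_le_div_of_nonneg_right (le_max_right _ _) hn2.le

/-! ### The normal form -/

/-- **Normal form of `Nolin2008_thm24_fiveArm_upper`.** The recorded five-arm upper bound (all
non-constant `κ : Fin 5 → Bool`, all inner radii `m ≥ 1`) is EQUIVALENT to the conjunction of the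
two statements "`∃ m₀, ∀ m ≥ m₀, ∃ C, ∀ n ≥ m, P_{1/2}(armEvent κ m n) ≤ C/n²`" for
`κ = (T,F,F,F,F)` (KSZ 1998, Lemma 5, (3.8): "one of which is vacant and the other four of which
are occupied") and for `κ = (T,F,T,F,F)` (Nolin's `σ = BWBBW` up to the colour flip, together with
the adjacent arrangement `BBWWW` of the same colours, the order being free in `armEvent`). [cite: Nolin2008, §5.2 Thm. 24, five-arm item, with §4.1 and §2.1 (arXiv 0711.4948: Thm. 23 (iii))] [cite: KestenSidoraviciusZhang1998, Lemma 5, (3.7)–(3.8)] -/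
theorem Nolin2008_thm24_fiveArm_upper_iff :
    Nolin2008_thm24_fiveArm_upper ↔
      (∃ m₀ : ℕ, ∀ m : ℕ, m₀ ≤ m → ∃ C : ℝ, ∀ n : ℕ, m ≤ n →
          polyArmProb ![true, false, false, false, false] m n ≤ C / (n : ℝ) ^ 2) ∧
        (∃ m₀ : ℕ, ∀ m : ℕ, m₀ ≤ m → ∃ C : ℝ, ∀ n : ℕ, m ≤ n →
          polyArmProb ![true, false, true, false, false] m n ≤ C / (n : ℝ) ^ 2) := by
  constructor
  · intro h
    exact ⟨⟨1, fun m hm => h _ ⟨0, 1, by decide⟩ m hm⟩, ⟨1, fun m hm => h _ ⟨0, 1, by decide⟩ m hm⟩⟩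
  · rintro ⟨h₁, h₂⟩ κ hκ m hm
    rcases polyArmProb_eq_one_or_two κ hκ with h | h
    · obtain ⟨C, hC⟩ := fiveArm_pointUpper_of_eventually _ h₁ m hm
      exact ⟨C, fun n hn => (h m n).le.trans (hC n hn)⟩
    · obtain ⟨C, hC⟩ := fiveArm_pointUpper_of_eventually _ h₂ m hm
      exact ⟨C, fun n hn => (h m n).le.trans (hC n hn)⟩

/-- **The sufficient half, spelled out**: the two large-inner-radius bounds imply the recorded
fact. [cite: Nolin2008, §5.2 Thm. 24, five-arm item (arXiv 0711.4948: Thm. 23 (iii))] -/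
theorem Nolin2008_thm24_fiveArm_upper_of_two
    (h₁ : ∃ m₀ : ℕ, ∀ m : ℕ, m₀ ≤ m → ∃ C : ℝ, ∀ n : ℕ, m ≤ n →
      polyArmProb ![true, false, false, false, false] m n ≤ C / (n : ℝ) ^ 2)
    (h₂ : ∃ m₀ : ℕ, ∀ m : ℕ, m₀ ≤ m → ∃ C : ℝ, ∀ n : ℕ, m ≤ n →
      polyArmProb ![true, false, true, false, false] m n ≤ C / (n : ℝ) ^ 2) :
    Nolin2008_thm24_fiveArm_upper :=
  Nolin2008_thm24_fiveArm_upper_iff.2 ⟨h₁, h₂⟩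

end Literature.Probability.Percolation
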